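import Literature.Combinatorics.Optimization.TracialDesigns
import Literature.Barriers.PneNP.MatchingSlackPsdSupportBarrier
import Literature.Barriers.PneNP.TSPExtensionComplexityRothvossCounts
import HarnessLib

/-!
# Pure-state witnesses: the tracial value at dimension `C(n,2) + 1` bounds every rectangle, without tightness

Everything here is PROVED (no named facts). Vocabulary: `Literature.Combinatorics.Optimization.TracialDesigns`
(`IsPsdRect`, `TracialValueLEAt`, `OddSet`, `PMatch`, `cc`) and the support-barrier factor vectors of
`Literature.Barriers.PneNP.MatchingSlackPsdSupportBarrier` (`rowFactor U = (1[e ∈ δ(U)])_e ⊕ (−1)`,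
`colFactor M = (1[e ∈ M])_e ⊕ 1` in `ℝ^{E(K_n) ⊕ 1}`, with `⟨a_U, b_M⟩ = |δ(U) ∩ M| − 1`,
`pmOddCutSlack_eq_sum_factor` — the ordinary rank factorisation behind FGPRT Thm 2.9 (v) / §5.2
[cite: FawziEtAl2015, Thm. 2.9 (v) (p06–p07); §5.2 (p15)]).

THE WITNESS. For weights `x : OddSet n → [0,1]`, `y : PMatch n → [0,1]` put, in dimension `r₀ = C(n,2)+1`,
`X_U = (x_U / ‖a_U‖²)·a_Ua_Uᵀ` and `Y_M = (y_M / ‖b_M‖²)·b_Mb_Mᵀ` (scaled rank-one projections — "pure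
states"). Then `0 ⪯ X_U, Y_M ⪯ I`, and `X_U Y_M = (…)·⟨a_U,b_M⟩·a_Ub_Mᵀ = 0` EXACTLY on the tight pairs
`|δ(U) ∩ M| = 1`, with NO condition on the supports of `x, y`; and `tr(X_U Y_M) = x_U y_M (|δ(U) ∩ M| − 1)² /
(‖a_U‖² ‖b_M‖²)`. Consequently (`rectSq_le_of_tracialValueLEAt`):

  `TracialValueLEAt W γ (C(n,2)+1)  ⇒  Σ_U Σ_M W(U,M)·x_U·y_M·(|δ(U)∩M| − 1)² / (‖a_U‖²‖b_M‖²) ≤ (C(n,2)+1)·γ`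

for EVERY fractional rectangle `x ⊗ y` — in particular for 0/1 rectangles `A × B` that MEET the tight
level. For a multilevel planted weight `W = levelWeight n t C w` this left side is the rectangle value of
the REWEIGHTED profile `w'_c = (c − 1)²·w_c` (normalisers constant on `t`-cuts: `‖a_U‖² = 1 + |δ(U)|`,
`‖b_M‖² = 1 + |M|`, see `rowNormSq_eq` / `colNormSq_eq`), so any tracial decay statement at dimension
`≥ C(n,2)+1` (e.g. the cell's crux `TracialDecayExp20`, whose budget `r²n < e^{a·dq n}` admits `r₀` for
large `n`) forces decay of `(c−1)²`-reweighted designs on ALL rectangles, tight-free or not — a necessary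
`r = 1` condition (cell pnp-psdrank, lit g16 LIT-19 §2 / STATUS NOTE 2026-08-27). The same vectors with
`x = y = 1` are the psd factorisation of the Hadamard square `S ∘ S` of size `C(n,2)+1`
(`hasPsdFactorization_pmOddCutSlack_sq`). [cite: FawziEtAl2015, Thm. 2.9 (v) (p06–p07)]
[cite: BrietDadushPokutta2014, Thm. 6 (§3)] [cite: Rothvoss2017, §2 (PDF pp. 5–7)]
-/

noncomputable section

open Matrix Finset
open scoped MatrixOrder

namespace Literature.Combinatorics.Optimization

open Literature.Barriers.PneNP
open Literature.Combinatorics.SimpleGraph.CycleSpace (Crosses crosses_mk)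

/-! ### Scaled rank-one projections (generic index type) -/

section RankOne

variable {d : Type*} [Fintype d] [DecidableEq d]

omit [DecidableEq d] in
/-- `(c·aaᵀ)(c'·bbᵀ) = (c c' ⟨a,b⟩)·abᵀ`. [folklore] -/
private theorem smul_vecMulVec_mul_smul_vecMulVec (c c' : ℝ) (a b : d → ℝ) :
    (c • vecMulVec a a) * (c' • vecMulVec b b) = (c * c' * (a ⬝ᵥ b)) • vecMulVec a b := by
  rw [Matrix.smul_mul, Matrix.mul_smul, vecMulVec_mul_vecMulVec, vecMulVec_smul, smul_smul, smul_smul]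

omit [DecidableEq d] in
/-- `tr((c·aaᵀ)(c'·bbᵀ)) = c c' ⟨a,b⟩²`. [folklore] -/
private theorem trace_smul_vecMulVec_mul_smul_vecMulVec (c c' : ℝ) (a b : d → ℝ) :
    ((c • vecMulVec a a) * (c' • vecMulVec b b)).trace = c * c' * (a ⬝ᵥ b) ^ 2 := by
  rw [smul_vecMulVec_mul_smul_vecMulVec, trace_smul, trace_vecMulVec, smul_eq_mul, sq, mul_assoc]

omit [DecidableEq d] in
/-- A real symmetric idempotent matrix is positive semidefinite (`A = AᵀA`). [folklore] -/
private theorem posSemidef_of_transpose_of_idem {A : Matrix d d ℝ} (hs : Aᵀ = A) (hi : A * A = A) :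
    A.PosSemidef := by
  have h := posSemidef_conjTranspose_mul_self A
  rwa [conjTranspose_eq_transpose_of_trivial, hs, hi] at h

/-- … and so is `1 − A`. [folklore] -/
private theorem posSemidef_one_sub_of_transpose_of_idem {A : Matrix d d ℝ} (hs : Aᵀ = A) (hi : A * A = A) :
    (1 - A).PosSemidef := by
  refine posSemidef_of_transpose_of_idem (by rw [transpose_sub, transpose_one, hs]) ?_
  rw [Matrix.sub_mul, Matrix.one_mul, Matrix.mul_sub, Matrix.mul_one, hi, sub_self, sub_zero]

omit [DecidableEq d] in
/-- The normalised rank-one matrix `(a·a)⁻¹·aaᵀ` (for `a ≠ 0`) is an orthogonal projection: symmetric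
and idempotent. [folklore] -/
private theorem rankOneProj_idem {a : d → ℝ} (ha : a ⬝ᵥ a ≠ 0) :
    ((a ⬝ᵥ a)⁻¹ • vecMulVec a a) * ((a ⬝ᵥ a)⁻¹ • vecMulVec a a) = (a ⬝ᵥ a)⁻¹ • vecMulVec a a := by
  rw [smul_vecMulVec_mul_smul_vecMulVec, mul_assoc, inv_mul_cancel₀ ha, mul_one]

omit [Fintype d] [DecidableEq d] in
/-- `c·aaᵀ` is symmetric. [folklore] -/
private theorem rankOneProj_transpose (c : ℝ) (a : d → ℝ) : (c • vecMulVec a a)ᵀ = c • vecMulVec a a := by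
  rw [transpose_smul, transpose_vecMulVec]

omit [DecidableEq d] in
/-- **Scaled pure states are contractions.** For `0 ≤ x ≤ 1` and any vector `a`, the matrix
`X = (x/(a·a))·aaᵀ` satisfies `0 ⪯ X ⪯ I` (for `a = 0` it is `0`). [folklore] -/
private theorem scaledPureState_posSemidef {x : ℝ} (hx0 : 0 ≤ x) (a : d → ℝ) :
    ((x / (a ⬝ᵥ a)) • vecMulVec a a).PosSemidef := by
  have hpsd : (vecMulVec a a).PosSemidef := by
    simpa using posSemidef_vecMulVec_self_star a
  exact hpsd.smul (div_nonneg hx0 (by simpa using dotProduct_self_star_nonneg a))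

/-- `I − (x/(a·a))·aaᵀ ⪰ 0` for `x ≤ 1`. [folklore] -/
private theorem one_sub_scaledPureState_posSemidef {x : ℝ} (hx1 : x ≤ 1) (a : d → ℝ) :
    (1 - (x / (a ⬝ᵥ a)) • vecMulVec a a).PosSemidef := by
  by_cases ha : a ⬝ᵥ a = 0
  · have ha0 : a = 0 := dotProduct_self_eq_zero.1 ha
    simp only [ha0, vecMulVec_zero, smul_zero, sub_zero]
    exact PosSemidef.one
  · -- `1 − x·P = (1 − P) + (1 − x)·P` with `P` the projection onto `a`
    have hP1 := posSemidef_one_sub_of_transpose_of_idem (rankOneProj_transpose _ a) (rankOneProj_idem ha)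
    have hP := posSemidef_of_transpose_of_idem (rankOneProj_transpose _ a) (rankOneProj_idem ha)
    have hdecomp : 1 - (x / (a ⬝ᵥ a)) • vecMulVec a a =
        (1 - (a ⬝ᵥ a)⁻¹ • vecMulVec a a) + (1 - x) • ((a ⬝ᵥ a)⁻¹ • vecMulVec a a) := by
      rw [div_eq_mul_inv, ← smul_smul, sub_smul, one_smul]
      abel
    rw [hdecomp]
    exact hP1.add (hP.smul (by linarith))

end RankOne

/-! ### The factor vectors of the matching slack matrix, re-indexed by `Fin (C(n,2)+1)` -/

variable {n : ℕ}

/-- `|E(K_n) ⊕ 1| = C(n,2) + 1`. [folklore] -/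
private theorem card_edge_sum_unit (n : ℕ) : Fintype.card (Edge n ⊕ Unit) = n.choose 2 + 1 := by
  rw [Fintype.card_sum, Fintype.card_unit, Sym2.card_subtype_not_diag, Fintype.card_fin]

/-- The re-indexing `E(K_n) ⊕ 1 ≃ Fin (C(n,2)+1)`. [folklore] -/
def edgeIndex (n : ℕ) : Edge n ⊕ Unit ≃ Fin (n.choose 2 + 1) :=
  (Fintype.equivFin _).trans (finCongr (card_edge_sum_unit n))

/-- Row (odd-set) factor vector `a_U ∈ ℝ^{C(n,2)+1}`. [cite: FawziEtAl2015, Thm. 2.9 (v) proof (p07)] -/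
def rowVec (U : OddSet n) : Fin (n.choose 2 + 1) → ℝ := fun i => rowFactor U ((edgeIndex n).symm i)

/-- Column (matching) factor vector `b_M ∈ ℝ^{C(n,2)+1}`. [cite: FawziEtAl2015, Thm. 2.9 (v) proof (p07)] -/
def colVec (M : PMatch n) : Fin (n.choose 2 + 1) → ℝ := fun i => colFactor M ((edgeIndex n).symm i)

/-- `⟨a_U, b_M⟩ = |δ(U) ∩ M| − 1 = S(U,M)`. [cite: FawziEtAl2015, Thm. 2.9 (v) proof (p07)] -/
theorem rowVec_dotProduct_colVec (U : OddSet n) (M : PMatch n) :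
    rowVec U ⬝ᵥ colVec M = pmOddCutSlack n U M := by
  rw [pmOddCutSlack_eq_sum_factor]
  unfold rowVec colVec dotProduct
  exact Equiv.sum_comp (edgeIndex n).symm (fun z => rowFactor U z * colFactor M z)

/-- `‖a_U‖²`, the row normaliser (`= 1 + |δ(U)|`, `rowNormSq_eq`). [folklore] -/
def rowNormSq (U : OddSet n) : ℝ := rowVec U ⬝ᵥ rowVec U

/-- `‖b_M‖²`, the column normaliser (`= 1 + |M|`, `colNormSq_eq`). [folklore] -/
def colNormSq (M : PMatch n) : ℝ := colVec M ⬝ᵥ colVec M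

/-- `‖a_U‖² = 1 + #{e ∈ E(K_n) : e ∈ δ(U)}` (`= 1 + |U|(n − |U|)`) for the row factor vector of the
slack matrix's rank factorisation. [cite: FawziEtAl2015, Thm. 2.9 (v) (p06–p07)] -/
theorem rowNormSq_eq (U : OddSet n) :
    rowNormSq U = 1 + ((univ : Finset (Edge n)).filter (fun e => Crosses U.1 e.1)).card := by
  classical
  unfold rowNormSq dotProduct rowVec
  rw [Equiv.sum_comp (edgeIndex n).symm (fun z => rowFactor U z * rowFactor U z), Fintype.sum_sum_type]
  simp only [rowFactor, Fintype.sum_unique, mul_neg, mul_one, neg_neg, mul_ite, mul_zero]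
  rw [add_comm, Finset.card_filter, Nat.cast_sum]
  congr 1
  refine sum_congr rfl fun e _ => ?_
  by_cases h : Crosses U.1 e.1 <;> simp [h]

/-- `‖b_M‖² = 1 + #{e ∈ E(K_n) : e ∈ M}` (`= 1 + |M| = 1 + n/2` for a perfect matching of `K_n`) for the
column factor vector of the slack matrix's rank factorisation. [cite: FawziEtAl2015, Thm. 2.9 (v) (p06–p07)] -/
theorem colNormSq_eq (M : PMatch n) :
    colNormSq M = 1 + ((univ : Finset (Edge n)).filter (fun e => e.1 ∈ M.1)).card := by
  classical
  unfold colNormSq dotProduct colVec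
  rw [Equiv.sum_comp (edgeIndex n).symm (fun z => colFactor M z * colFactor M z), Fintype.sum_sum_type]
  simp only [colFactor, Fintype.sum_unique, mul_one, mul_ite, mul_zero]
  rw [add_comm, Finset.card_filter, Nat.cast_sum]
  congr 1
  refine sum_congr rfl fun e _ => ?_
  by_cases h : e.1 ∈ M.1 <;> simp [h]

/-! ### The pure-state psd rectangle on an arbitrary fractional rectangle -/

/-- Cut side of the witness: `X_U = (x_U/‖a_U‖²)·a_Ua_Uᵀ` — Theorem 2.9 (v)'s rank-one psd factor `a_Ua_Uᵀ`,
normalised to a projection and scaled by `x_U ∈ [0,1]`. [cite: FawziEtAl2015, Thm. 2.9 (v) (p06–p07)] -/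
def pureX (x : OddSet n → ℝ) (U : OddSet n) : Matrix (Fin (n.choose 2 + 1)) (Fin (n.choose 2 + 1)) ℝ :=
  (x U / rowNormSq U) • vecMulVec (rowVec U) (rowVec U)

/-- Matching side of the witness: `Y_M = (y_M/‖b_M‖²)·b_Mb_Mᵀ`. [cite: FawziEtAl2015, Thm. 2.9 (v) (p06–p07)] -/
def pureY (y : PMatch n → ℝ) (M : PMatch n) : Matrix (Fin (n.choose 2 + 1)) (Fin (n.choose 2 + 1)) ℝ :=
  (y M / colNormSq M) • vecMulVec (colVec M) (colVec M)

/-- `tr(X_U Y_M) = x_U y_M S(U,M)² / (‖a_U‖²‖b_M‖²)`: Theorem 2.9 (v)'s identity `⟨a_ia_iᵀ, b_jb_jᵀ⟩ = ⟨a_i,b_j⟩² =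
M_{ij}²` with the normalisations. [cite: FawziEtAl2015, Thm. 2.9 (v) (p06–p07)] -/
theorem trace_pureX_mul_pureY (x : OddSet n → ℝ) (y : PMatch n → ℝ) (U : OddSet n) (M : PMatch n) :
    (pureX x U * pureY y M).trace = x U * y M * pmOddCutSlack n U M ^ 2 / (rowNormSq U * colNormSq M) := by
  unfold pureX pureY
  rw [trace_smul_vecMulVec_mul_smul_vecMulVec, rowVec_dotProduct_colVec]
  unfold rowNormSq colNormSq
  ring

/-- The witness is TIGHT with no hypothesis on `x, y`: `X_U Y_M = 0` whenever `|δ(U) ∩ M| = 1` (the factor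
vectors are orthogonal exactly on the zeros of `S`, `⟨a_U,b_M⟩ = S(U,M)`). [cite: FawziEtAl2015, Thm. 2.9 (v) (p06–p07)] -/
theorem pureX_mul_pureY_eq_zero (x : OddSet n → ℝ) (y : PMatch n → ℝ) {U : OddSet n} {M : PMatch n}
    (h : cc U M = 1) : pureX x U * pureY y M = 0 := by
  unfold pureX pureY
  rw [smul_vecMulVec_mul_smul_vecMulVec, rowVec_dotProduct_colVec, pmOddCutSlack_apply, h]
  simp

/-- **The witness is a psd rectangle of dimension `C(n,2)+1`** (`IsPsdRect`) for all `0 ≤ x, y ≤ 1`: Theorem 2.9 (v)'s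
size-`rank(S)` psd factorisation of `S ∘ S`, restricted/scaled by `x ⊗ y`, in the route's contraction currency.
[cite: FawziEtAl2015, Thm. 2.9 (v) (p06–p07)] [cite: GriblingDelaatLaurent2019, §5 (p. 24)] -/
theorem isPsdRect_pure {x : OddSet n → ℝ} {y : PMatch n → ℝ} (hx : ∀ U, 0 ≤ x U ∧ x U ≤ 1)
    (hy : ∀ M, 0 ≤ y M ∧ y M ≤ 1) : IsPsdRect (pureX x) (pureY y) := by
  refine ⟨fun U => ⟨?_, ?_⟩, fun M => ⟨?_, ?_⟩, fun U M h => pureX_mul_pureY_eq_zero x y h⟩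
  · exact scaledPureState_posSemidef (hx U).1 _
  · exact one_sub_scaledPureState_posSemidef (hx U).2 _
  · exact scaledPureState_posSemidef (hy M).1 _
  · exact one_sub_scaledPureState_posSemidef (hy M).2 _

/-- **Pure-state witness lemma.** A tracial value bound `γ` in dimension `C(n,2)+1` bounds the
`S²`-weighted value of EVERY fractional rectangle `x ⊗ y` (no tightness / support condition on `x, y`):
`Σ_U Σ_M W(U,M) x_U y_M (|δ(U)∩M| − 1)² / (‖a_U‖²‖b_M‖²) ≤ (C(n,2)+1)·γ` — the tracial value
[cite: GriblingDelaatLaurent2019, §5 (p. 24)] of the weight `W` evaluated at Theorem 2.9 (v)'s rank-one factorisation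
of `S ∘ S` [cite: FawziEtAl2015, Thm. 2.9 (v) (p06–p07)] (the cell's necessary `r = 1` condition for tracial decay, pnp-psdrank lit g16). -/
theorem rectSq_le_of_tracialValueLEAt (W : OddSet n → PMatch n → ℝ) {γ : ℝ}
    (hW : TracialValueLEAt W γ (n.choose 2 + 1)) {x : OddSet n → ℝ} {y : PMatch n → ℝ}
    (hx : ∀ U, 0 ≤ x U ∧ x U ≤ 1) (hy : ∀ M, 0 ≤ y M ∧ y M ≤ 1) :
    ∑ U, ∑ M, W U M * (x U * y M * pmOddCutSlack n U M ^ 2 / (rowNormSq U * colNormSq M))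
      ≤ (n.choose 2 + 1 : ℕ) * γ := by
  have h := hW (pureX x) (pureY y) (isPsdRect_pure hx hy)
  simp_rw [trace_pureX_mul_pureY] at h
  have hr : (0 : ℝ) < (n.choose 2 + 1 : ℕ) := by exact_mod_cast Nat.succ_pos _
  rw [div_le_iff₀ hr] at h
  linarith

/-- The 0/1-rectangle form: for `A ⊆ 𝒰`, `B ⊆ ℳ` arbitrary (possibly meeting the tight level),
`Σ_{U ∈ A} Σ_{M ∈ B} W(U,M)(|δ(U)∩M| − 1)²/(‖a_U‖²‖b_M‖²) ≤ (C(n,2)+1)·γ`.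
[cite: FawziEtAl2015, Thm. 2.9 (v) (p06–p07)] [cite: GriblingDelaatLaurent2019, §5 (p. 24)] -/
theorem rectSq_le_of_tracialValueLEAt_finset (W : OddSet n → PMatch n → ℝ) {γ : ℝ}
    (hW : TracialValueLEAt W γ (n.choose 2 + 1)) (A : Finset (OddSet n)) (B : Finset (PMatch n)) :
    ∑ U ∈ A, ∑ M ∈ B, W U M * (pmOddCutSlack n U M ^ 2 / (rowNormSq U * colNormSq M))
      ≤ (n.choose 2 + 1 : ℕ) * γ := by
  classical
  have h := rectSq_le_of_tracialValueLEAt W hW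
    (x := fun U => if U ∈ A then 1 else 0) (y := fun M => if M ∈ B then 1 else 0)
    (fun U => by by_cases hU : U ∈ A <;> simp [hU]) (fun M => by by_cases hM : M ∈ B <;> simp [hM])
  have hpt : ∀ U M, W U M * ((if U ∈ A then (1:ℝ) else 0) * (if M ∈ B then (1:ℝ) else 0) *
      pmOddCutSlack n U M ^ 2 / (rowNormSq U * colNormSq M))
      = if U ∈ A then (if M ∈ B then W U M * (pmOddCutSlack n U M ^ 2 / (rowNormSq U * colNormSq M))
        else 0) else 0 := by
    intro U M
    split_ifs <;> simp
  simp_rw [hpt] at h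
  have key : ∑ U ∈ A, ∑ M ∈ B, W U M * (pmOddCutSlack n U M ^ 2 / (rowNormSq U * colNormSq M))
      = ∑ U, ∑ M, (if U ∈ A then (if M ∈ B then
          W U M * (pmOddCutSlack n U M ^ 2 / (rowNormSq U * colNormSq M)) else 0) else 0) := by
    symm
    calc ∑ U, ∑ M, (if U ∈ A then (if M ∈ B then
            W U M * (pmOddCutSlack n U M ^ 2 / (rowNormSq U * colNormSq M)) else 0) else 0)
        = ∑ U, (if U ∈ A then ∑ M ∈ B, W U M * (pmOddCutSlack n U M ^ 2 / (rowNormSq U * colNormSq M))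
            else 0) := by
          refine sum_congr rfl fun U _ => ?_
          by_cases hU : U ∈ A
          · simp only [hU, if_true]
            exact Finset.sum_ite_mem_eq B _
          · simp [hU]
      _ = ∑ U ∈ A, ∑ M ∈ B, W U M * (pmOddCutSlack n U M ^ 2 / (rowNormSq U * colNormSq M)) :=
          Finset.sum_ite_mem_eq A _
  rw [key]
  exact h

/-! ### The normalisers on `t`-cuts × perfect matchings, and the level form of the witness lemma -/

/-- The non-loop edges lying in a perfect matching `M` of `K_n` are exactly the `|M| = n/2` edges of `M`
(`IsPMOn`: no loops). [cite: Rothvoss2017, §1 (PDF p. 4)] -/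
theorem card_edge_filter_mem (M : PMatch n) :
    ((univ : Finset (Edge n)).filter (fun e => e.1 ∈ M.1)).card = M.1.card := by
  classical
  refine Finset.card_bij (fun e _ => e.1) (fun e he => (mem_filter.1 he).2)
    (fun e₁ _ e₂ _ h => Subtype.ext h) (fun e he => ?_)
  exact ⟨⟨e, M.2.2.1 e he⟩, by simp [he], rfl⟩

/-- `‖b_M‖² = 1 + n/2` for a perfect matching `M` of `K_n`. [cite: FawziEtAl2015, Thm. 2.9 (v) (p06–p07)] -/
theorem colNormSq_pmatch (M : PMatch n) : colNormSq M = 1 + (n : ℝ) / 2 := by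
  rw [colNormSq_eq, card_edge_filter_mem]
  have h := IsPMOn.two_mul_card M.2
  rw [Finset.card_univ, Fintype.card_fin] at h
  have h' : ((M.1.card : ℕ) : ℝ) = (n : ℝ) / 2 := by
    rw [eq_div_iff (two_ne_zero), mul_comm]; exact_mod_cast h
  rw [h']

/-- The non-loop edges crossing a vertex set `U ⊆ Fin n` are in bijection with `U × (Fin n ∖ U)`:
`|δ(U)| = |U|·(n − |U|)`. [cite: Rothvoss2017, §2 (PDF p. 5)] -/
theorem card_edge_filter_crosses (U : Finset (Fin n)) :
    ((univ : Finset (Edge n)).filter (fun e => Crosses U e.1)).card = U.card * (n - U.card) := by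
  classical
  have hc : (univ \ U).card = n - U.card := by
    rw [Finset.card_univ_sdiff, Fintype.card_fin]
  rw [← hc, ← Finset.card_product]
  symm
  refine Finset.card_bij (fun p hp => ⟨s(p.1, p.2), ?_⟩) (fun p hp => ?_) (fun p₁ hp₁ p₂ hp₂ h => ?_)
    (fun e he => ?_)
  · -- non-diagonal
    obtain ⟨h1, h2⟩ := Finset.mem_product.1 hp
    rw [Sym2.mk_isDiag_iff]
    intro h12
    exact (Finset.mem_sdiff.1 h2).2 (h12 ▸ h1)
  · obtain ⟨h1, h2⟩ := Finset.mem_product.1 hp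
    simp only [mem_filter, mem_univ, true_and, crosses_mk]
    exact Or.inl ⟨h1, (Finset.mem_sdiff.1 h2).2⟩
  · obtain ⟨ha1, hb1⟩ := Finset.mem_product.1 hp₁
    obtain ⟨ha2, hb2⟩ := Finset.mem_product.1 hp₂
    have h' : s(p₁.1, p₁.2) = s(p₂.1, p₂.2) := congrArg Subtype.val h
    rcases Sym2.eq_iff.1 h' with ⟨h1, h2⟩ | ⟨h1, h2⟩
    · exact Prod.ext h1 h2
    · exact absurd (h1 ▸ ha1) (Finset.mem_sdiff.1 hb2).2
  · obtain ⟨e, he'⟩ := e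
    induction e using Sym2.ind with
    | h x y =>
      have hcr : Crosses U s(x, y) := (mem_filter.1 he).2
      rw [crosses_mk] at hcr
      rcases hcr with ⟨hx, hy⟩ | ⟨hx, hy⟩
      · exact ⟨(x, y), Finset.mem_product.2 ⟨hx, Finset.mem_sdiff.2 ⟨mem_univ _, hy⟩⟩, rfl⟩
      · refine ⟨(y, x), Finset.mem_product.2 ⟨hy, Finset.mem_sdiff.2 ⟨mem_univ _, hx⟩⟩, ?_⟩
        exact Subtype.ext (Sym2.eq_swap)

/-- `‖a_U‖² = 1 + |U|(n − |U|)`; on `t`-cuts (`|U| = t`) this is the constant `1 + t(n − t)`.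
[cite: FawziEtAl2015, Thm. 2.9 (v) (p06–p07)] -/
theorem rowNormSq_eq_card (U : OddSet n) : rowNormSq U = 1 + (U.1.card : ℝ) * ((n : ℝ) - U.1.card) := by
  rw [rowNormSq_eq, card_edge_filter_crosses]
  have hle : U.1.card ≤ n := by
    simpa using Finset.card_le_univ U.1
  push_cast [Nat.cast_sub hle]
  ring

/-- **Pure-state witness lemma, level form on `t`-cuts.** If `TracialValueLEAt W γ (C(n,2)+1)` then for every
family `A` of `t`-cuts and every set `B` of perfect matchings (NO tight-freeness assumed),
`Σ_{U∈A} Σ_{M∈B} W(U,M)·(|δ(U)∩M| − 1)² ≤ (C(n,2)+1)·(1 + t(n−t))·(1 + n/2)·γ`. For `W = levelWeight n t C w` the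
left side is `Σ_c w_c (c−1)²·|Q_c(t) ∩ (A×B)|/|Q_c(t)|`, the rectangle value of the reweighted profile
`(c−1)²·w_c`. [cite: FawziEtAl2015, Thm. 2.9 (v) (p06–p07)] [cite: GriblingDelaatLaurent2019, §5 (p. 24)]
[cite: Rothvoss2017, §2 (PDF pp. 5–7)] -/
theorem rectCcSq_le_of_tracialValueLEAt (W : OddSet n → PMatch n → ℝ) {γ : ℝ}
    (hW : TracialValueLEAt W γ (n.choose 2 + 1)) {t : ℕ} (ht : t ≤ n) (A : Finset (OddSet n))
    (hA : ∀ U ∈ A, U.1.card = t) (B : Finset (PMatch n)) :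
    ∑ U ∈ A, ∑ M ∈ B, W U M * ((cc U M : ℝ) - 1) ^ 2
      ≤ (n.choose 2 + 1 : ℕ) * ((1 + (t : ℝ) * ((n : ℝ) - t)) * (1 + (n : ℝ) / 2)) * γ := by
  have h := rectSq_le_of_tracialValueLEAt_finset W hW A B
  have h1 : (1 : ℝ) ≤ 1 + (t : ℝ) * ((n : ℝ) - t) := by
    have : (0 : ℝ) ≤ (t : ℝ) * ((n : ℝ) - t) :=
      mul_nonneg (Nat.cast_nonneg _) (sub_nonneg.2 (by exact_mod_cast ht))
    linarith
  have h2 : (1 : ℝ) ≤ 1 + (n : ℝ) / 2 := by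
    have : (0 : ℝ) ≤ (n : ℝ) / 2 := by positivity
    linarith
  have hN : 0 < (1 + (t : ℝ) * ((n : ℝ) - t)) * (1 + (n : ℝ) / 2) := mul_pos (by linarith) (by linarith)
  have key : ∑ U ∈ A, ∑ M ∈ B, W U M * ((cc U M : ℝ) - 1) ^ 2
      = ((1 + (t : ℝ) * ((n : ℝ) - t)) * (1 + (n : ℝ) / 2)) *
        ∑ U ∈ A, ∑ M ∈ B, W U M * (pmOddCutSlack n U M ^ 2 / (rowNormSq U * colNormSq M)) := by
    rw [Finset.mul_sum]
    refine sum_congr rfl fun U hU => ?_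
    rw [Finset.mul_sum]
    refine sum_congr rfl fun M _ => ?_
    rw [rowNormSq_eq_card, colNormSq_pmatch, hA U hU, pmOddCutSlack_apply]
    field_simp
  rw [key]
  calc ((1 + (t : ℝ) * ((n : ℝ) - t)) * (1 + (n : ℝ) / 2)) *
        ∑ U ∈ A, ∑ M ∈ B, W U M * (pmOddCutSlack n U M ^ 2 / (rowNormSq U * colNormSq M))
      ≤ ((1 + (t : ℝ) * ((n : ℝ) - t)) * (1 + (n : ℝ) / 2)) * ((n.choose 2 + 1 : ℕ) * γ) :=
        mul_le_mul_of_nonneg_left h hN.le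
    _ = (n.choose 2 + 1 : ℕ) * ((1 + (t : ℝ) * ((n : ℝ) - t)) * (1 + (n : ℝ) / 2)) * γ := by ring

end Literature.Combinatorics.Optimization

end
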